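import Summits.Langlands.Langlands.Theorems.HalfIntegralTwistCM.Negative.ParityAndDatum
import HarnessLib

/-!
# `HalfIntegralTwistCM` (stmt-Langlands-14036) — negative knowledge VI: the integer shifts are
# necessary and must be non-uniform

Sorry-free, unconditional (cdisprove gen 2, cycle 1). The one-page proof of the crux takes
`p ι := 1/2 - s₁ ι + N_ι` with integers `N_ι` chosen so that `p σ_w + p σ̄_w = 1 - E_w/2`. Two NATURAL
STRENGTHENINGS of the conclusion are refuted here:

* `not_halfIntegralTwistCM_uniformShift` — "one integer `N` works for all `ι`"
  (`∃ χ N, χ` has parameter `{1/2 - s₁ ι + N}`) is FALSE over every CM field with two complex places,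
  concretely `ℚ(ζ₅)`;
* `not_halfIntegralTwistCM_exact` — a fortiori the EXACT half-twist `p = 1/2 - s₁` (`N = 0`) is FALSE.

Witness: `s₁ = (1/2)·𝟙_{mk ι = w₁}`, `s₂ = -s₁`, `ω = π_𝟙` (parameter `{0}`): hypotheses (i)–(iv) of the
crux hold, while exponents `1/2 - s₁ + N` have `Re (p σ_{w₁} + p σ̄_{w₁}) = 2N` and
`Re (p σ_{w₂} + p σ̄_{w₂}) = 1 + 2N`, contradicting the parallelism of real parts of the exponents of any
`GL₁` datum (`exists_re_archParam_parallel_glOne`, `|θ| = ‖·‖^σ`). Moral for the prover: the shifts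
`N_ι` must depend on `ι` through `j_w = ((s₁-s₂) σ_w + (s₁-s₂) σ̄_w)/2`, exactly as in the informal
proof (`N_{σ_w} + N_{σ̄_w} = j_w + const`). [folklore]
-/

noncomputable section

open scoped MatrixGroups Matrix Classical NumberField ComplexConjugate
open NumberField NumberField.InfinitePlace NumberField.mixedEmbedding IsDedekindDomain

namespace Summit.Langlands.Langlands.Theorems.HalfIntegralTwistCM.Negative

open Literature.NumberTheory.Automorphic
open Literature.NumberTheory.GaloisRepresentations

/-- **The uniform-shift strengthening of the crux is FALSE over every CM field with two complex
places** (unconditional). Witness `s₁ = (1/2)·𝟙_{mk ι = w₁}`, `s₂ = -s₁`, `ω = π_𝟙`; obstruction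
`exists_re_archParam_parallel_glOne`. [folklore] -/
theorem not_halfIntegralTwistCM_uniformShift_of_two_complex_places
    {K : Type} [Field K] [NumberField K] [hK : NumberField.IsCMField K]
    (w₁ w₂ : {w : InfinitePlace K // w.IsComplex}) (hne : w₁ ≠ w₂) :
    ¬ (∀ (K : Type) [Field K] [NumberField K], NumberField.IsCMField K →
        ∀ (h1 : Literature.NumberTheory.Automorphic.isCompact_glFiniteIntegralLevel 1 K)
          (s₁ s₂ : (K →+* ℂ) → ℂ), (∀ ι, ∃ k : ℤ, s₁ ι - s₂ ι = k) →
          (∀ ι, ∃ m : ℤ, s₁ ι - s₁ (NumberField.ComplexEmbedding.conjugate ι) = m) →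
          (∀ ι, ∃ m : ℤ, (s₁ ι - s₂ ι) + (s₁ (NumberField.ComplexEmbedding.conjugate ι) -
            s₂ (NumberField.ComplexEmbedding.conjugate ι)) = 2 * m) →
          (∃ ω : Literature.NumberTheory.Automorphic.CuspidalAutomorphicRepData 1 K h1,
            ω.1.HasArchParameter (fun ι => {s₁ ι + s₂ ι})) →
          ∃ (χ : Literature.NumberTheory.Automorphic.CuspidalAutomorphicRepData 1 K h1) (N : ℤ),
            χ.1.HasArchParameter (fun ι => {1 / 2 - s₁ ι + N})) := by
  intro hC
  classical
  set h1 : isCompact_glFiniteIntegralLevel 1 K := isCompact_glFiniteIntegralLevel_holds 1 K with hh1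
  -- the exponents `s₁ = (1/2)·𝟙_{w₁}`, `s₂ = -s₁`
  set s : (K →+* ℂ) → ℂ := fun ι => if InfinitePlace.mk ι = w₁.1 then 1 / 2 else 0 with hs
  have hsconj : ∀ ι, s (ComplexEmbedding.conjugate ι) = s ι := fun ι => by
    simp only [hs, mk_conjugate_eq]
  -- the trivial datum `π_𝟙`, parameter `{0} = {s + (-s)}`
  obtain ⟨τ, hτW, hτW'⟩ := exists_automorphicRepData_detTwist_glOne h1 (1 : HeckeCharacter K)
  have hcusp : τ.W ≤ cuspFormsGL 1 K h1 := by
    rw [hτW, Submodule.span_le]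
    rintro _ rfl
    exact IsCuspFormGL.mem_cuspFormsGL
      ⟨isAutomorphicForm_detTwist_glOne h1 (1 : HeckeCharacter K), fun k hk hk1 => absurd hk1 (by omega)⟩
  have hχτ := detTwist_datum_heckeCharacter (hcpt := h1) (θ := (1 : HeckeCharacter K)) hτW
  obtain ⟨E, hE⟩ := τ.exists_hasArchParameter_glOne
  have hE0 : E = fun ι => ({s ι + -s ι} : Multiset ℂ) := by
    funext ι
    rw [add_neg_cancel]
    exact archParam_trivial_glOne τ hχτ hE ι
  -- hypotheses (i)–(iii)
  have hi : ∀ ι : K →+* ℂ, ∃ k : ℤ, s ι - -s ι = k := by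
    intro ι
    by_cases h : InfinitePlace.mk ι = w₁.1
    · exact ⟨1, by simp [hs, h]; norm_num⟩
    · exact ⟨0, by simp [hs, h]⟩
  have hii : ∀ ι : K →+* ℂ, ∃ m : ℤ, s ι - s (ComplexEmbedding.conjugate ι) = m :=
    fun ι => ⟨0, by rw [hsconj]; simp⟩
  have hiii : ∀ ι : K →+* ℂ, ∃ m : ℤ, (s ι - -s ι) + (s (ComplexEmbedding.conjugate ι) -
      -s (ComplexEmbedding.conjugate ι)) = 2 * m := by
    intro ι
    rw [hsconj]
    by_cases h : InfinitePlace.mk ι = w₁.1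
    · exact ⟨1, by simp [hs, h]; norm_num⟩
    · exact ⟨0, by simp [hs, h]⟩
  obtain ⟨χ, N, hP⟩ := hC K hK h1 s (fun ι => -s ι) hi hii hiii ⟨⟨τ, hcusp⟩, by rw [← hE0]; exact hE⟩
  -- parallel real parts for `χ`
  obtain ⟨σ, -, hcplx⟩ := exists_re_archParam_parallel_glOne χ.1 hP
  have hPar : ∀ w : {w : InfinitePlace K // w.IsComplex},
      ((1 / 2 - s w.1.embedding + N) + (1 / 2 - s (ComplexEmbedding.conjugate w.1.embedding) + N)).re
        = 2 * σ := fun w => hcplx w _ _ rfl rfl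
  have hw₂ : w₂.1 ≠ w₁.1 := fun h => hne (Subtype.ext h).symm
  have e₁ : s w₁.1.embedding = 1 / 2 := by simp [hs, mk_embedding]
  have e₂ : s w₂.1.embedding = 0 := by simp [hs, mk_embedding, hw₂]
  have p₁ := hPar w₁
  have p₂ := hPar w₂
  rw [hsconj, e₁] at p₁
  rw [hsconj, e₂] at p₂
  simp only [Complex.add_re, Complex.sub_re, Complex.zero_re, Complex.intCast_re] at p₁ p₂
  have q2 : ((1 : ℂ) / 2).re = 1 / 2 := by norm_num
  simp only [q2] at p₁ p₂
  linarith

/-- **The uniform-shift strengthening of the crux is FALSE** (unconditional; witness the CM quartic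
`ℚ(ζ₅)`): no single integer `N` makes `1/2 - s₁ + N` automorphic in general — the shifts of the
one-page proof must depend on the embedding. [folklore] -/
theorem not_halfIntegralTwistCM_uniformShift :
    ¬ (∀ (K : Type) [Field K] [NumberField K], NumberField.IsCMField K →
        ∀ (h1 : Literature.NumberTheory.Automorphic.isCompact_glFiniteIntegralLevel 1 K)
          (s₁ s₂ : (K →+* ℂ) → ℂ), (∀ ι, ∃ k : ℤ, s₁ ι - s₂ ι = k) →
          (∀ ι, ∃ m : ℤ, s₁ ι - s₁ (NumberField.ComplexEmbedding.conjugate ι) = m) →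
          (∀ ι, ∃ m : ℤ, (s₁ ι - s₂ ι) + (s₁ (NumberField.ComplexEmbedding.conjugate ι) -
            s₂ (NumberField.ComplexEmbedding.conjugate ι)) = 2 * m) →
          (∃ ω : Literature.NumberTheory.Automorphic.CuspidalAutomorphicRepData 1 K h1,
            ω.1.HasArchParameter (fun ι => {s₁ ι + s₂ ι})) →
          ∃ (χ : Literature.NumberTheory.Automorphic.CuspidalAutomorphicRepData 1 K h1) (N : ℤ),
            χ.1.HasArchParameter (fun ι => {1 / 2 - s₁ ι + N})) := by
  haveI : NumberField.IsCMField K₅ := isCMField_K₅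
  have h : 1 < Fintype.card (InfinitePlace K₅) := by rw [card_infinitePlace_K₅]; decide
  obtain ⟨v₁, v₂, hne⟩ := Fintype.exists_pair_of_one_lt_card h
  exact not_halfIntegralTwistCM_uniformShift_of_two_complex_places (K := K₅)
    ⟨v₁, NumberField.IsTotallyComplex.isComplex v₁⟩ ⟨v₂, NumberField.IsTotallyComplex.isComplex v₂⟩
    (fun e => hne (congrArg Subtype.val e))

/-- **The exact half-twist strengthening of the crux is FALSE** (unconditional; witness `ℚ(ζ₅)`):
`p = 1/2 - s₁` itself is in general NOT the archimedean parameter of a `GL₁` datum — the integer shifts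
of the one-page proof are necessary (a fortiori from the uniform-shift case `N = 0`). [folklore] -/
theorem not_halfIntegralTwistCM_exact :
    ¬ (∀ (K : Type) [Field K] [NumberField K], NumberField.IsCMField K →
        ∀ (h1 : Literature.NumberTheory.Automorphic.isCompact_glFiniteIntegralLevel 1 K)
          (s₁ s₂ : (K →+* ℂ) → ℂ), (∀ ι, ∃ k : ℤ, s₁ ι - s₂ ι = k) →
          (∀ ι, ∃ m : ℤ, s₁ ι - s₁ (NumberField.ComplexEmbedding.conjugate ι) = m) →
          (∀ ι, ∃ m : ℤ, (s₁ ι - s₂ ι) + (s₁ (NumberField.ComplexEmbedding.conjugate ι) -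
            s₂ (NumberField.ComplexEmbedding.conjugate ι)) = 2 * m) →
          (∃ ω : Literature.NumberTheory.Automorphic.CuspidalAutomorphicRepData 1 K h1,
            ω.1.HasArchParameter (fun ι => {s₁ ι + s₂ ι})) →
          ∃ χ : Literature.NumberTheory.Automorphic.CuspidalAutomorphicRepData 1 K h1,
            χ.1.HasArchParameter (fun ι => {1 / 2 - s₁ ι})) := by
  intro h
  refine not_halfIntegralTwistCM_uniformShift fun K _ _ hK h1 s₁ s₂ hi hii hiii hiv => ?_
  obtain ⟨χ, hχ⟩ := h K hK h1 s₁ s₂ hi hii hiii hiv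
  refine ⟨χ, 0, ?_⟩
  have : (fun ι : K →+* ℂ => ({1 / 2 - s₁ ι + ((0 : ℤ) : ℂ)} : Multiset ℂ)) =
      fun ι => ({1 / 2 - s₁ ι} : Multiset ℂ) := by
    funext ι; push_cast; rw [add_zero]
  rw [this]; exact hχ

end Summit.Langlands.Langlands.Theorems.HalfIntegralTwistCM.Negative
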